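import Mathlib
import Summits.Ventures.PercRepro2.Defs
import Summits.Ventures.PercRepro2.Harris
import Summits.Ventures.PercRepro2.Graph
import Summits.Ventures.PercRepro2.Events
import Summits.Ventures.PercRepro2.PsiPinInduction
import Summits.Ventures.PercRepro2.PsiUniSure
import Summits.Ventures.PercRepro2.PsiUniExplored
import Summits.Ventures.PercRepro2.PsiTEdge
import Summits.Ventures.PercRepro2.R21PinInduction
import Summits.Ventures.PercRepro2.R21OEdgeSGraph
import Summits.Ventures.PercRepro2.R21OEdgeS

/-!
# Closed-world relations for the `s`-edge case of (UNI-R⁺_o) (PercRepro2, p2)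

The `D_y`-masses, the masses of the conditional Harris inequality (c1) and the cells of the
certificate, all in the atoms of `sEdge_masses` (`N = {o ∉ C_s}`, `𝟙 = {s ↮ y}`, `ℓ = {o ↔ y}`,
`a = {s ↔ u}`, `O_u = {o ↔ u}`, `Y_u = {y ↔ u}`, `S = {s ↔ y}`) and the new atoms
`K₅ = P(N S a)`, `K₃ = P(N S aᶜ O_u)`, `K₁ = P(N S aᶜ O_uᶜ)`, `P(N S)`, `Z₁ = P(N ℓ aᶜ O_u)`,
`Z₃ = P(N ℓ aᶜ O_uᶜ)`, `G = P(N 𝟙 ℓᶜ O_uᶜ aᶜ Y_u)`, `Z₂ = P(N 𝟙 ℓᶜ O_uᶜ aᶜ Y_uᶜ)`, `A = P(aᶜ h Y_u)`.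
-/

namespace Summit.Ventures.PercRepro2

section SEdgePlusMasses

variable {V : Type*} {E : Type*} [Fintype E] [DecidableEq E] {R : Type*} [CommRing R]

/-- Closed-world relations for the `s`-edge case of (UNI-R⁺_o). -/
lemma sEdge_dy_masses (q : E → R) (ends : E → Sym2 V) (s y o u : V) :
    prob q ((connEvent ends o s)ᶜ ∩ connEvent ends o u) = prob q ((connEvent ends o s)ᶜ ∩ ((connEvent ends s y)ᶜ ∩ (connEvent ends o y)ᶜ) ∩ connEvent ends o u) + prob q ((connEvent ends o s)ᶜ ∩ connEvent ends o y ∩ (connEvent ends s u)ᶜ ∩ connEvent ends o u) + prob q ((connEvent ends o s)ᶜ ∩ connEvent ends s y ∩ (connEvent ends s u)ᶜ ∩ connEvent ends o u) ∧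
      prob q ((connEvent ends o s)ᶜ ∩ ((connEvent ends s y)ᶜ ∩ (connEvent ends o y)ᶜ)) = prob q ((connEvent ends o s)ᶜ ∩ ((connEvent ends s y)ᶜ ∩ (connEvent ends o y)ᶜ) ∩ connEvent ends o u) + prob q ((connEvent ends o s)ᶜ ∩ ((connEvent ends s y)ᶜ ∩ (connEvent ends o y)ᶜ) ∩ connEvent ends s u) + prob q ((connEvent ends o s)ᶜ ∩ ((connEvent ends s y)ᶜ ∩ (connEvent ends o y)ᶜ) ∩ (connEvent ends o u)ᶜ ∩ (connEvent ends s u)ᶜ ∩ connEvent ends y u) + prob q ((connEvent ends o s)ᶜ ∩ ((connEvent ends s y)ᶜ ∩ (connEvent ends o y)ᶜ) ∩ (connEvent ends o u)ᶜ ∩ (connEvent ends s u)ᶜ ∩ (connEvent ends y u)ᶜ) ∧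
      prob q ((connEvent ends o s)ᶜ ∩ connEvent ends o y) = prob q ((connEvent ends o s)ᶜ ∩ connEvent ends o y ∩ connEvent ends s u) + prob q ((connEvent ends o s)ᶜ ∩ connEvent ends o y ∩ (connEvent ends s u)ᶜ ∩ (connEvent ends o u)ᶜ) + prob q ((connEvent ends o s)ᶜ ∩ connEvent ends o y ∩ (connEvent ends s u)ᶜ ∩ connEvent ends o u) ∧
      prob q ((connEvent ends o s)ᶜ) = prob q ((connEvent ends o s)ᶜ ∩ ((connEvent ends s y)ᶜ ∩ (connEvent ends o y)ᶜ)) + prob q ((connEvent ends o s)ᶜ ∩ connEvent ends o y) + prob q ((connEvent ends o s)ᶜ ∩ connEvent ends s y) ∧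
      prob q ((connEvent ends o s)ᶜ ∩ connEvent ends s y) = prob q ((connEvent ends o s)ᶜ ∩ connEvent ends s y ∩ (connEvent ends s u)ᶜ ∩ (connEvent ends o u)ᶜ) + prob q ((connEvent ends o s)ᶜ ∩ connEvent ends s y ∩ (connEvent ends s u)ᶜ ∩ connEvent ends o u) + prob q ((connEvent ends o s)ᶜ ∩ connEvent ends s y ∩ connEvent ends s u) ∧
      prob q ((connEvent ends s u)ᶜ ∩ connEvent ends s y ∩ connEvent ends o u) = prob q ((connEvent ends o s)ᶜ ∩ connEvent ends s y ∩ (connEvent ends s u)ᶜ ∩ connEvent ends o u) ∧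
      prob q ((connEvent ends s y)ᶜ ∩ (connEvent ends s o)ᶜ ∩ (connEvent ends y o)ᶜ) = prob q ((connEvent ends o s)ᶜ ∩ ((connEvent ends s y)ᶜ ∩ (connEvent ends o y)ᶜ)) ∧
      prob q (connEvent ends s o ∩ (connEvent ends s y)ᶜ) = prob q (connEvent ends o s ∩ (connEvent ends s y)ᶜ) ∧
      prob q ((connEvent ends s o)ᶜ ∩ connEvent ends s y ∩ connEvent ends s u) = prob q ((connEvent ends o s)ᶜ ∩ connEvent ends s y ∩ connEvent ends s u) ∧
      prob q (connEvent ends s u ∩ connEvent ends s o ∩ (connEvent ends s y)ᶜ) = prob q (connEvent ends o s ∩ (connEvent ends s y)ᶜ ∩ connEvent ends s u) ∧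
      prob q ((connEvent ends s o)ᶜ ∩ connEvent ends s y) = prob q ((connEvent ends o s)ᶜ ∩ connEvent ends s y) ∧
      prob q ((connEvent ends s u)ᶜ ∩ (connEvent ends o u)ᶜ ∩ connEvent ends y u) = prob q ((connEvent ends o s)ᶜ ∩ ((connEvent ends s y)ᶜ ∩ (connEvent ends o y)ᶜ) ∩ (connEvent ends o u)ᶜ ∩ (connEvent ends s u)ᶜ ∩ connEvent ends y u) + prob q ((connEvent ends s u)ᶜ ∩ connEvent ends s o ∩ connEvent ends y u) ∧
      prob q (connEvent ends s u ∩ connEvent ends s y ∩ ((connEvent ends o s)ᶜ ∩ (connEvent ends o y)ᶜ)) = prob q ((connEvent ends o s)ᶜ ∩ connEvent ends s y ∩ connEvent ends s u) ∧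
      prob q (connEvent ends s y ∩ ((connEvent ends o s)ᶜ ∩ (connEvent ends o y)ᶜ)) = prob q ((connEvent ends o s)ᶜ ∩ connEvent ends s y) ∧
      prob q (connEvent ends s u ∩ ((connEvent ends o s)ᶜ ∩ (connEvent ends o y)ᶜ)) = prob q ((connEvent ends o s)ᶜ ∩ ((connEvent ends s y)ᶜ ∩ (connEvent ends o y)ᶜ) ∩ connEvent ends s u) + prob q ((connEvent ends o s)ᶜ ∩ connEvent ends s y ∩ connEvent ends s u) ∧
      prob q ((connEvent ends o s)ᶜ ∩ (connEvent ends o y)ᶜ) = prob q ((connEvent ends o s)ᶜ ∩ ((connEvent ends s y)ᶜ ∩ (connEvent ends o y)ᶜ)) + prob q ((connEvent ends o s)ᶜ ∩ connEvent ends s y) := by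
  have hsplit : ∀ (A B : Set (Config E)), prob q A = prob q (A ∩ B) + prob q (A ∩ Bᶜ) :=
    fun A B => (prob_inter_add_prob_inter_compl q A B).symm
  refine ⟨?_, ?_, ?_, ?_, ?_, ?_, ?_, ?_, ?_, ?_, ?_, ?_, ?_, ?_, ?_, ?_⟩
  · -- (r1) `N O_u = N O_u S ⊔ N O_u 𝟙 ℓ ⊔ N O_u 𝟙 ℓᶜ`
    rw [hsplit ((connEvent ends o s)ᶜ ∩ connEvent ends o u) (connEvent ends s y), hsplit ((connEvent ends o s)ᶜ ∩ connEvent ends o u ∩ (connEvent ends s y)ᶜ) (connEvent ends o y)]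
    have e1 : (connEvent ends o s)ᶜ ∩ connEvent ends o u ∩ connEvent ends s y = (connEvent ends o s)ᶜ ∩ connEvent ends s y ∩ (connEvent ends s u)ᶜ ∩ connEvent ends o u := by
      ext ω
      simp only [Set.mem_inter_iff, Set.mem_compl_iff, mem_connEvent]
      constructor
      · rintro ⟨⟨hnos, hou⟩, hsy⟩
        exact ⟨⟨⟨hnos, hsy⟩, fun hsu => hnos (conn_trans hou (conn_symm hsu))⟩, hou⟩
      · rintro ⟨⟨⟨hnos, hsy⟩, _⟩, hou⟩
        exact ⟨⟨hnos, hou⟩, hsy⟩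
    have e2 : (connEvent ends o s)ᶜ ∩ connEvent ends o u ∩ (connEvent ends s y)ᶜ ∩ connEvent ends o y = (connEvent ends o s)ᶜ ∩ connEvent ends o y ∩ (connEvent ends s u)ᶜ ∩ connEvent ends o u := by
      ext ω
      simp only [Set.mem_inter_iff, Set.mem_compl_iff, mem_connEvent]
      constructor
      · rintro ⟨⟨⟨hnos, hou⟩, _⟩, hoy⟩
        exact ⟨⟨⟨hnos, hoy⟩, fun hsu => hnos (conn_trans hou (conn_symm hsu))⟩, hou⟩
      · rintro ⟨⟨⟨hnos, hoy⟩, _⟩, hou⟩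
        exact ⟨⟨⟨hnos, hou⟩, fun hsy => hnos (conn_trans hoy (conn_symm hsy))⟩, hoy⟩
    have e3 : (connEvent ends o s)ᶜ ∩ connEvent ends o u ∩ (connEvent ends s y)ᶜ ∩ (connEvent ends o y)ᶜ = (connEvent ends o s)ᶜ ∩ ((connEvent ends s y)ᶜ ∩ (connEvent ends o y)ᶜ) ∩ connEvent ends o u := by
      ext ω; simp only [Set.mem_inter_iff]; tauto
    rw [e1, e2, e3]; ring
  · -- (r2) `N 𝟙 ℓᶜ = N 𝟙 ℓᶜ O_u ⊔ N 𝟙 ℓᶜ a ⊔ (connEvent ends o s)ᶜ ∩ ((connEvent ends s y)ᶜ ∩ (connEvent ends o y)ᶜ) ∩ (connEvent ends o u)ᶜ ∩ (connEvent ends s u)ᶜ ∩ connEvent ends y u ⊔ Z₂`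
    rw [hsplit ((connEvent ends o s)ᶜ ∩ ((connEvent ends s y)ᶜ ∩ (connEvent ends o y)ᶜ)) (connEvent ends o u), hsplit ((connEvent ends o s)ᶜ ∩ ((connEvent ends s y)ᶜ ∩ (connEvent ends o y)ᶜ) ∩ (connEvent ends o u)ᶜ) (connEvent ends s u), hsplit ((connEvent ends o s)ᶜ ∩ ((connEvent ends s y)ᶜ ∩ (connEvent ends o y)ᶜ) ∩ (connEvent ends o u)ᶜ ∩ (connEvent ends s u)ᶜ) (connEvent ends y u)]
    have e2 : (connEvent ends o s)ᶜ ∩ ((connEvent ends s y)ᶜ ∩ (connEvent ends o y)ᶜ) ∩ (connEvent ends o u)ᶜ ∩ connEvent ends s u = (connEvent ends o s)ᶜ ∩ ((connEvent ends s y)ᶜ ∩ (connEvent ends o y)ᶜ) ∩ connEvent ends s u := by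
      ext ω
      simp only [Set.mem_inter_iff, Set.mem_compl_iff, mem_connEvent]
      constructor
      · rintro ⟨⟨h2, _⟩, hsu⟩
        exact ⟨h2, hsu⟩
      · rintro ⟨⟨hnos, h1⟩, hsu⟩
        exact ⟨⟨⟨hnos, h1⟩, fun hou => hnos (conn_trans hou (conn_symm hsu))⟩, hsu⟩
    rw [e2]; ring
  · -- (r3) `N ℓ = N ℓ a ⊔ Z₁ ⊔ Z₃`
    rw [hsplit ((connEvent ends o s)ᶜ ∩ connEvent ends o y) (connEvent ends s u), hsplit ((connEvent ends o s)ᶜ ∩ connEvent ends o y ∩ (connEvent ends s u)ᶜ) (connEvent ends o u)]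
    ring
  · -- (r4) `N = N 𝟙 ℓᶜ ⊔ N ℓ ⊔ N S`
    rw [hsplit ((connEvent ends o s)ᶜ) (connEvent ends s y), hsplit ((connEvent ends o s)ᶜ ∩ (connEvent ends s y)ᶜ) (connEvent ends o y)]
    have e1 : (connEvent ends o s)ᶜ ∩ (connEvent ends s y)ᶜ ∩ connEvent ends o y = (connEvent ends o s)ᶜ ∩ connEvent ends o y := by
      ext ω
      simp only [Set.mem_inter_iff, Set.mem_compl_iff, mem_connEvent]
      constructor
      · rintro ⟨⟨hnos, _⟩, hoy⟩
        exact ⟨hnos, hoy⟩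
      · rintro ⟨hnos, hoy⟩
        exact ⟨⟨hnos, fun hsy => hnos (conn_trans hoy (conn_symm hsy))⟩, hoy⟩
    have e2 : (connEvent ends o s)ᶜ ∩ (connEvent ends s y)ᶜ ∩ (connEvent ends o y)ᶜ = (connEvent ends o s)ᶜ ∩ ((connEvent ends s y)ᶜ ∩ (connEvent ends o y)ᶜ) := Set.inter_assoc _ _ _
    rw [e1, e2]; ring
  · -- (r5) `N S = K₅ ⊔ K₃ ⊔ K₁`
    rw [hsplit ((connEvent ends o s)ᶜ ∩ connEvent ends s y) (connEvent ends s u), hsplit ((connEvent ends o s)ᶜ ∩ connEvent ends s y ∩ (connEvent ends s u)ᶜ) (connEvent ends o u)]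
    ring
  · -- (r7) `aᶜ S O_u = K₃`
    congr 1
    ext ω
    simp only [Set.mem_inter_iff, Set.mem_compl_iff, mem_connEvent]
    constructor
    · rintro ⟨⟨hnsu, hsy⟩, hou⟩
      exact ⟨⟨⟨fun hos => hnsu (conn_trans (conn_symm hos) hou), hsy⟩, hnsu⟩, hou⟩
    · rintro ⟨⟨⟨_, hsy⟩, hnsu⟩, hou⟩
      exact ⟨⟨hnsu, hsy⟩, hou⟩
  · -- (r8) `𝟙 hᶜ ℓᶜ = N 𝟙 ℓᶜ`
    congr 1
    ext ω
    simp only [Set.mem_inter_iff, Set.mem_compl_iff, mem_connEvent]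
    constructor
    · rintro ⟨⟨hnsy, hnso⟩, hnyo⟩
      exact ⟨fun hos => hnso (conn_symm hos), hnsy, fun hoy => hnyo (conn_symm hoy)⟩
    · rintro ⟨hnos, hnsy, hnoy⟩
      exact ⟨⟨hnsy, fun hso => hnos (conn_symm hso)⟩, fun hyo => hnoy (conn_symm hyo)⟩
  · -- (r9) `h 𝟙`
    congr 1
    rw [connEvent_comm ends s o]
  · -- (r10) `hᶜ S a = K₅`
    congr 1
    rw [connEvent_comm ends s o]
  · -- (r11) `a h 𝟙`
    congr 1
    rw [connEvent_comm ends s o]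
    ext ω; simp only [Set.mem_inter_iff]; tauto
  · -- (r12) `hᶜ S = N S`
    congr 1
    rw [connEvent_comm ends s o]
  · -- (r13) `aᶜ O_uᶜ Y_u = (connEvent ends o s)ᶜ ∩ ((connEvent ends s y)ᶜ ∩ (connEvent ends o y)ᶜ) ∩ (connEvent ends o u)ᶜ ∩ (connEvent ends s u)ᶜ ∩ connEvent ends y u ⊔ A`
    rw [hsplit ((connEvent ends s u)ᶜ ∩ (connEvent ends o u)ᶜ ∩ connEvent ends y u) (connEvent ends o s)]
    have e1 : (connEvent ends s u)ᶜ ∩ (connEvent ends o u)ᶜ ∩ connEvent ends y u ∩ connEvent ends o s = (connEvent ends s u)ᶜ ∩ connEvent ends s o ∩ connEvent ends y u := by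
      ext ω
      simp only [Set.mem_inter_iff, Set.mem_compl_iff, mem_connEvent]
      constructor
      · rintro ⟨⟨⟨hnsu, _⟩, hyu⟩, hos⟩
        exact ⟨⟨hnsu, conn_symm hos⟩, hyu⟩
      · rintro ⟨⟨hnsu, hso⟩, hyu⟩
        exact ⟨⟨⟨hnsu, fun hou => hnsu (conn_trans hso hou)⟩, hyu⟩, conn_symm hso⟩
    have e2 : (connEvent ends s u)ᶜ ∩ (connEvent ends o u)ᶜ ∩ connEvent ends y u ∩ (connEvent ends o s)ᶜ = (connEvent ends o s)ᶜ ∩ ((connEvent ends s y)ᶜ ∩ (connEvent ends o y)ᶜ) ∩ (connEvent ends o u)ᶜ ∩ (connEvent ends s u)ᶜ ∩ connEvent ends y u := by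
      ext ω
      simp only [Set.mem_inter_iff, Set.mem_compl_iff, mem_connEvent]
      constructor
      · rintro ⟨⟨⟨hnsu, hnou⟩, hyu⟩, hnos⟩
        exact ⟨⟨⟨⟨hnos, fun hsy => hnsu (conn_trans hsy hyu), fun hoy => hnou (conn_trans hoy hyu)⟩,
          hnou⟩, hnsu⟩, hyu⟩
      · rintro ⟨⟨⟨⟨hnos, _⟩, hnou⟩, hnsu⟩, hyu⟩
        exact ⟨⟨⟨hnsu, hnou⟩, hyu⟩, hnos⟩
    rw [e1, e2]; ring
  · -- (r14) `a S D = K₅`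
    congr 1
    ext ω
    simp only [Set.mem_inter_iff, Set.mem_compl_iff, mem_connEvent]
    constructor
    · rintro ⟨⟨hsu, hsy⟩, ⟨hnos, _⟩⟩
      exact ⟨⟨hnos, hsy⟩, hsu⟩
    · rintro ⟨⟨hnos, hsy⟩, hsu⟩
      exact ⟨⟨hsu, hsy⟩, ⟨hnos, fun hoy => hnos (conn_trans hoy (conn_symm hsy))⟩⟩
  · -- (r15) `S D = N S`
    congr 1
    ext ω
    simp only [Set.mem_inter_iff, Set.mem_compl_iff, mem_connEvent]
    constructor
    · rintro ⟨hsy, ⟨hnos, _⟩⟩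
      exact ⟨hnos, hsy⟩
    · rintro ⟨hnos, hsy⟩
      exact ⟨hsy, ⟨hnos, fun hoy => hnos (conn_trans hoy (conn_symm hsy))⟩⟩
  · -- (r16) `a D = N 𝟙 ℓᶜ a ⊔ K₅`
    rw [hsplit (connEvent ends s u ∩ ((connEvent ends o s)ᶜ ∩ (connEvent ends o y)ᶜ)) (connEvent ends s y)]
    have e1 : connEvent ends s u ∩ ((connEvent ends o s)ᶜ ∩ (connEvent ends o y)ᶜ) ∩ connEvent ends s y = (connEvent ends o s)ᶜ ∩ connEvent ends s y ∩ connEvent ends s u := by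
      ext ω
      simp only [Set.mem_inter_iff, Set.mem_compl_iff, mem_connEvent]
      constructor
      · rintro ⟨⟨hsu, ⟨hnos, _⟩⟩, hsy⟩
        exact ⟨⟨hnos, hsy⟩, hsu⟩
      · rintro ⟨⟨hnos, hsy⟩, hsu⟩
        exact ⟨⟨hsu, ⟨hnos, fun hoy => hnos (conn_trans hoy (conn_symm hsy))⟩⟩, hsy⟩
    have e2 : connEvent ends s u ∩ ((connEvent ends o s)ᶜ ∩ (connEvent ends o y)ᶜ) ∩ (connEvent ends s y)ᶜ = (connEvent ends o s)ᶜ ∩ ((connEvent ends s y)ᶜ ∩ (connEvent ends o y)ᶜ) ∩ connEvent ends s u := by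
      ext ω; simp only [Set.mem_inter_iff]; tauto
    rw [e1, e2]; ring
  · -- (r17) `D = N 𝟙 ℓᶜ ⊔ N S`
    rw [hsplit ((connEvent ends o s)ᶜ ∩ (connEvent ends o y)ᶜ) (connEvent ends s y)]
    have e1 : (connEvent ends o s)ᶜ ∩ (connEvent ends o y)ᶜ ∩ connEvent ends s y = (connEvent ends o s)ᶜ ∩ connEvent ends s y := by
      ext ω
      simp only [Set.mem_inter_iff, Set.mem_compl_iff, mem_connEvent]
      constructor
      · rintro ⟨⟨hnos, _⟩, hsy⟩
        exact ⟨hnos, hsy⟩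
      · rintro ⟨hnos, hsy⟩
        exact ⟨⟨hnos, fun hoy => hnos (conn_trans hoy (conn_symm hsy))⟩, hsy⟩
    have e2 : (connEvent ends o s)ᶜ ∩ (connEvent ends o y)ᶜ ∩ (connEvent ends s y)ᶜ = (connEvent ends o s)ᶜ ∩ ((connEvent ends s y)ᶜ ∩ (connEvent ends o y)ᶜ) := by
      ext ω; simp only [Set.mem_inter_iff]; tauto
    rw [e1, e2]; ring

end SEdgePlusMasses

end Summit.Ventures.PercRepro2
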